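import Summits.BirchSwinnertonDyer.Rank1Residual.F1Sign2.CasselsTateSignAtTwo
import HarnessLib.Audit.Tags
import HarnessLib

/-!
# Cell `bsd-f1-sign2` — descent lens (planner `-desc` g22; MEMO-desc §30): THE DEPTH BIT OF PRIME DOOR TWINS HAS NO RESIDUE–TRACE GOVERNING LAW («spin type, not Rédei type») —
# DESC-30-O(m,k) `CasselsTateSignResidueTraceLawAtTwo`, DESC-30-NG `NoResidueTraceGoverningLawAtTwo`, NG₁, DESC-30-F_k `DoorFrobeniusRigidityAtTwo`, DESC-30-N₀ `OddBranchRankOneTwinShaAnBitAtTwo`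

STATEMENTS ONLY (+ -desc's two proved glue lemmas and the kernel rung `doorFrobeniusRigidityAtTwo_one`, + REF1's two certificates), typer -ty g16.  Source: -desc g22's
`HOME/MEMO-desc-data/g22/lean/Sketch30.lean` **57351541b55f3898** (imports `F1Sign2.CasselsTateSignAtTwo`; farm rc 0, 0 warnings, 0 sorry; BC7 `bc7_30.out` 4/4 CLEAN) l.47–137
VERBATIM (preamble, carrier `OnOddBranchRankOneAtTwo`, the rows, the glue; decl bodies byte-identical, builder-verified; ns `Summit.BirchSwinnertonDyer.Rank1Residual.F1Sign2`;
`@[conjecture]` rows NG / NG₁ / N₀ keep the attribute — `HarnessLib.Audit.Tags` imported), each docstring = -desc's VERBATIM + one «REF1-AUDIT §182» sentence + the REF2 status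
(placed by REF2 v49 §5 and CORRECTED by v50 §1.8 — folded below by -ty g17; -desc's own placement MEMO-desc §30.6 quoted where useful); then REF1 §182's sorry-free certificates C182f `residueTraceLaw_zero_modulus`
(the `0 < m` guard of NG is load-bearing) and C182g `doorFrobeniusRigidityAtTwo_zero` from `HOME/REF1-data/b182/lean/Probe182b.lean` 3000770e03b690d6 VERBATIM (ns `REF1g16j` → `F1Sign2`).

-desc's header (verbatim core).  «Setting.  `W` on the odd branch (tree `OnOddBranchAtTwo`: `Δ > 0`, `E(ℚ)[2] = 0`, rank 0, `Ш(W)[2] ≅ (ℤ/2)²`, every descent-admissible twist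
has `#Sel₂ = 8`) or on the RANK-ONE odd branch (`OnOddBranchRankOneAtTwo` below: rank 1, `#Sel₂(W) = 2`, every admissible twist has `#Sel₂ = 4`).  For an admissible PRIME `q`
(`d = −q ≡ 1 (8)`, `(−q/ℓ) = 1` at odd bad `ℓ`, `a_q` odd — a "3-cycle door prime") the twin `W^{(−q)}` carries ONE Cassels–Tate bit `θ(W^{(−q)}) := ShaTwoInTwiceShaFour (W^{(−q)})`
(`+` ⟺ the form vanishes on `Sel₂`; PARI `ellrank` `s = 0`).  MEMO-desc §15 F5 refuted the 2-ADIC elementary laws DESC-O_k (`θ` a function of `(q, a_q) mod 2^k`, `k ≤ 7`).  §30 asks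
for the WHOLE elementary class — residues of `q` modulo the odd bad primes (cubic / quartic residue symbols live there), `ℓ`-division data for odd `ℓ`, resolvent-field unit symbols —
and explains by a group-theoretic rigidity lemma why that class is everything a governing field inside `ℚ^{ab}·ℚ(E[2^∞])·(2-power torsor fields)` can see.  DESC-30-O(m,k):
CENSUS-REFUTED for every tested `(m,k)` — TEST 33 (g8 table, 2 301 prime twins of 82 rank-0 odd-branch classes, `q ≤ 11 987`) and ENGINE 34 (kit `j327395`, 5 601 prime twins of 24
rank-1 odd-branch curves, `q ≤ 40 000`, residues modulo EVERY odd bad prime): in all 40 keys the number of key-classes containing both signs equals the no-law expectation (ratio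
observed/expected `1.00 ± 0.05`).  DESC-30-NG: for EVERY odd-branch `W` and EVERY `(m,k)`, `0 < m`, two admissible primes in the same `(q mod m, a_q mod 2^k)` class carry opposite
signs; by DESC-30-F this is EQUIVALENT to «no governing field for `q ↦ θ(W^{(−q)})` inside the compositum of `ℚ^{ab}`, `ℚ(E[2^∞])` and the fields of all `E[2^j]`-torsors».
DESC-30-F_k (THEOREM-GRADE tool, pure linear algebra; kernel rung `k = 1`): in `M₂(ℤ/2^k)` two matrices with the same ODD trace and the same unit determinant are conjugate.
DESC-30-N₀: on the rank-one odd branch the twin of analytic rank 0 has `16 ∣ #Ш_an` iff `θ = +` and `#Ш_an ≡ 4 (8)` iff `θ = −`; TWO-ENGINE CENSUS (ENGINE 34): algebraic `s` (PARI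
`ellrank`, GRH-free) vs analytic `v₂` of the Birch modular-symbol sum: 5 601/5 601.  bears_on: `stmt-BirchSwinnertonDyer-19099` `RankOneAtTwo` / leaf `NonCMAtTwo` (N₀ is its
consequence on the rank-0 twins; NG says the BSD₂ depth bit of the twin is NOT Chebotarev-predictable from `W` through the 2-power Kummer–torsor tower: any proof of the `M ≥ 1`
rungs of `GenusKolyvaginAtTwo` U⁺_T / L_T must pass through the `q`-dependent field `ℚ(√−q)` itself, as the Heegner–Kolyvagin route does).  Data: `HOME/MEMO-desc-data/g22/`.»
REF1-AUDIT §182 (2026-08-29T08:03Z; register `HOME/REF1-AUDIT-v1.md` 98d761792356f0cc l.3286; evidence `HOME/REF1-data/b182/`: `Probe182b.lean` rc 0; E-side `check182b.py`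
55ec66882c99ea0e: rigidity brute force `k ≤ 4`, ENGINE 34 two-engine cross-tab 5 601/5 601 re-tallied, 24/24 NG witness pairs re-derived with own `a_q` + admissibility, random 150-row
check, no-law statistic re-tally 96/96/96.0 and 1 417/913/919.5) VERDICT verbatim: «Sketch30: O(m,k) = name of a refuted law (C182f: m = 0 makes it TRUE, so NG's 0<m is
load-bearing); NG/NG₁ conjecture-grade, non-vacuous (admissible primes have density > 0 per class; suggest a ¬CM guard for D-0131(3)); F_k THEOREM-GRADE (Galois-ring proof correct;
brute force k ≤ 4: one GL₂-orbit per odd (tr,det) class, sizes 2/8/32/128; even-trace control splits; k = 0 rung by decide); N₀ = BSD₂-consequence prediction (two-engine 5601/5601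
re-tallied; 24/24 witness pairs + 150-row a_q/admissibility sample re-derived). -ty: all 14 are portable as typed.»  REF2-PLACEMENT v49 §5.2 (333e5dcafceb55cb, 2026-08-29T08:36Z) — -desc's §30.6 placement
ACCURATE with locators: [cite: Smith2016GoverningFields, Thm. 3.2] «Assume A has full 2-torsion over k» (arXiv 1607.07860 p0008 L53–59: a governing field EXISTS when `E[2] ⊂ E(ℚ)` —
opposite sign, disjoint hypothesis); printed TEMPLATE of NG = [cite: KoymansMilovic2021Spins, Thm. 3] «Assume C_n for all n. Then there is no governing field for the 16-rank of ℚ(√−4p)»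
(arXiv 1809.09597 p0004 L22; against Cohn–Lagarias 1983, k ≤ 3 Stevenhagen), mechanism = [cite: FIMR2013Spin, §12] spin; F_k KNOWN (folklore); N₀ a BSD₂-prediction — then **CORRECTED by
REF2-PLACEMENT v50 §1.8 (dbb0660368a6f605, 09:05Z)**: (a) v49's «elliptic S₃-image analogue (CT bit of prime twists of a curve WITHOUT rational 2-torsion as a function of the prime):
NOT IN PRINT, positive or negative» is RETRACTED — the POSITIVE law IS IN PRINT: [cite: Morgan2023KummerGeneric, Prop. 19] (arXiv 2309.02374 flat numbering; PLMS doi:10.1112/plms.70066):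
`CTP(𝔞,𝔟) + CTP_χ(𝔞,𝔟) = Σ_{v ∈ Ram(χ)∖Σ} ψ_{a,b}(Frob_v)`, i.e. `θ(q) = c_W + ψ_{a,b}(Frob_q)` for admissible primes `q` — a function of `Frob_q` in Morgan's field `K_{T,T′}` (= -desc §31's
`M_W`, degree 96/192, where `ψ ≠ 0 ⟺` residue degree 6), NOT of `(q mod m, a_q mod 2^k)`; (b) NG's `K_T`-part («θ is not a function of Frob_q in the torsor compositum») is now a
COROLLARY OF PRINT ([cite: Morgan2023KummerGeneric, Cor. 34] + Čebotarev), the `ℚ^{ab}` enlargement is two lines on Prop. 26/31 (`Gal(M_W/L) ≅ 2^{1+4}_+` non-abelian ⟹ `M_W ⊄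
K_T·ℚ^{ab}`), the `ℚ(E[2^∞])` enlargement is the ONE residual lemma (not in print, census-backed TEST 33/ENGINE 34) ⟹ NG's grade moves from «conjecture, NEW-COMBINATION» to
«COROLLARY-OF-PRINT candidate (Cor. 34 + disjointness lemma)»; (c) the carrier v49 pointed at («primes of ℚ(E[4]) / of the 2-Selmer element fields above q») is the quadratic
extension `M_W` of the 2-Selmer-element compositum `K_T` (MEMO-desc §31 = Morgan §3–§4, REF2 v50 §1).  PARTITION none; beyond-print theorem: no; BSD is not proved by any of this;
no item closed.
-/

noncomputable section

open scoped Classical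

open WeierstrassCurve Literature.NumberTheory.EllipticCurves

namespace Summit.BirchSwinnertonDyer.Rank1Residual.F1Sign2

/-- The RANK-ONE odd branch: `Δ > 0`, `E(ℚ)[2] = 0`, rank `1`, `#Sel₂(W) = 2` (so `Ш(W)[2] = 0`) and every descent-admissible twist has
`#Sel₂(W^{(d)}) = 4` (the generator lies on the identity real component; `Sel₂(W^{(d)}) = Ш(W^{(d)})[2] ∋ κ(P)` when the twin has rank 0).
REF1-AUDIT §182 (carrier): FAITHFUL («every admissible twin has `#Sel₂ = 4`» is T-A/T-C's UP branch = identity-component generator; ENGINE 31: all 198 `σ = 1, φ = 1` rows have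
`dim Sel₂(W^d) = 2`); inhabited by the 24 ENGINE-34 curves modulo the identification `#Sel₂ = 2·#(E(ℚ)/2)` there (an `@[conjecture]`-free inhabitation proof in the kernel is not
available, as for every F1Sign2 population predicate). -/
def OnOddBranchRankOneAtTwo (W : WeierstrassCurve ℚ) [W.IsGloballyMinimal] : Prop :=
  0 < W.Δ ∧ NoRationalTwoTorsion W ∧ W.mordellWeilRank = 1 ∧ selmerTwoCard W = 2 ∧
    ∀ d : ℤ, DescAdmissible W d → twistSelmerTwoCard W d = 4

/-- **DESC-30-O(m,k) `CasselsTateSignResidueTraceLawAtTwo m k` (census-REFUTED for every tested `(m,k)`; typed so that its negation per curve,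
DESC-30-NG, has a name).** For `W` on the odd branch and admissible PRIME twists `−q`, `−q'`: if `q ≡ q' (mod m)` and `a_q ≡ a_{q'} (mod 2^k)` then
`θ(W^{(−q)}) = θ(W^{(−q')})`.  The case `m = 2^k` is MEMO-desc §15 DESC-O_k. [cite: Fisher2022quartics, Thm. 3.1 (the pairing both sign engines implement)]
REF1-AUDIT §182: **well-typed NAME for a census-refuted law (not a candidate)**; C182f (below): at `m = 0` (`ZMod 0 = ℤ`) the law is TRUE for every `k` (`q = q'` forced) — so the
`0 < m` guard in NG is load-bearing; `k = 0` is harmless (`ZMod 1`); E-side (`check182b.py` 55ec66882c99ea0e): the 24 explicit `(16·rad_odd N, 2)` witness pairs re-derived with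
REF1's own `a_q` (48/48) and every `DescAdmissible(W, −q)` clause checked (24/24; e.g. 1922a1: `q = 127, 2111`, `2111 − 127 = 4·496`); random 150 rows `a_q` 150/150,
admissibility 150/150; the no-law statistic re-tallied by independent code: key `(q mod 16, a_q mod 4)` 96 groups / 96 violating / 96.0 expected, key `+ (q mod ℓ)_ℓ` 1 417 / 913 /
919.5 — identical to CENSUS34.  REF2-PLACEMENT v49 §5.2 + v50 §1.8: -desc's placement accurate ([cite: Smith2016GoverningFields, Thm. 3.2] needs `E[2] ⊂ E(ℚ)`; the case `m = 2^k` is MEMO-desc §15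
DESC-O_k); WHY every O(m,k) fails is now print: the CT bit of admissible prime twists is `c_W + ψ_{a,b}(Frob_q)` read in Morgan's non-abelian field `K_{T,T′}`
([cite: Morgan2023KummerGeneric, Prop. 19, Cor. 34]), and a 3-cycle `Frob_q` fixes no vector of `E[2^j]`, so `Ĥ⁰ = 0`, `H¹(⟨Frob_q⟩, E[2^j]) = 0` — every 2-power torsor splits
at `q` in a way fixed by the division-field Frobenius (REF2 v49 (b) «torsor blindness», the separator from Rédei-type governed invariants, which ALSO fail residue–trace tests). -/
def CasselsTateSignResidueTraceLawAtTwo (m k : ℕ) : Prop :=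
  ∀ (W : WeierstrassCurve ℚ) [W.IsElliptic] [W.IsGloballyMinimal], OnOddBranchAtTwo W →
    ∀ q q' : ℕ, q.Prime → q'.Prime → DescAdmissible W (-(q : ℤ)) → DescAdmissible W (-(q' : ℤ)) →
      (q : ZMod m) = q' → (W.frobeniusTrace q : ZMod (2 ^ k)) = W.frobeniusTrace q' →
        (ShaTwoInTwiceShaFour (W.quadraticTwist (-(q : ℚ))) ↔ ShaTwoInTwiceShaFour (W.quadraticTwist (-(q' : ℚ))))

/-- Glue: the residue–trace laws are monotone — a law for `(m, k)` implies the law for every `(m', k')` with `m ∣ m'`, `k ≤ k'`. -/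
theorem residueTraceLaw_of_dvd {m m' k k' : ℕ} (hm : m ∣ m') (hk : k ≤ k') :
    CasselsTateSignResidueTraceLawAtTwo m k → CasselsTateSignResidueTraceLawAtTwo m' k' := by
  intro h W _ _ hodd q q' hq hq' hd hd' hqq haa
  refine h W hodd q q' hq hq' hd hd' ?_ ?_
  · have := congrArg (ZMod.castHom hm (ZMod m)) hqq
    simpa using this
  · have := congrArg (ZMod.castHom (pow_dvd_pow 2 hk) (ZMod (2 ^ k))) haa
    simpa using this

/-- **DESC-30-NG `NoResidueTraceGoverningLawAtTwo` (`@[conjecture]`, the §30 typed candidate; census = TEST 33 + ENGINE 34, BC5).** For every `W` on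
the odd branch and every modulus `m ≥ 1` and level `k`, there are admissible primes `q ≡ q' (mod m)` with `a_q ≡ a_{q'} (mod 2^k)` and
`θ(W^{(−q)}) = +`, `θ(W^{(−q')}) = −`: the Cassels–Tate bit of prime door twins is not a function of any residue–trace datum — by DESC-30-F, no
governing field inside `ℚ^{ab}·ℚ(E[2^∞])·{2-power torsor fields}`. [cite: Smith2016GoverningFields, Thm. 3.2 (governing field when `E[2] ⊂ E(ℚ)` — the
mechanism that fails here)]
REF1-AUDIT §182: **SURVIVES as an `@[conjecture]` candidate (honestly labelled; BC5 = TEST 33 + ENGINE 34)**; non-vacuity: `OnOddBranchAtTwo` is inhabited (the 17 ENGINE-V curves, e.g.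
42093b1, modulo the same certificate facts as DESC-29-V), and admissible primes exist in every class (the three abelian conditions force `(Δ_W/q) = +1` when `Δ_W > 0` — R182a's
reciprocity, the quadratic shadow of the 3-cycle class — so Chebotarev gives density `2/3·` within the class); strength flag (not a defect): `∀ m` makes NG equivalent (via F) to
«no governing field in `ℚ^{ab}·ℚ(E[2^∞])·{2-power torsor fields}`»; CM curves are NOT excluded by `OnOddBranchAtTwo` (`j = 0` curves `x³ + k` have `E(ℚ)[2] = 0`; for them the
natural governing datum is a quartic/spin symbol, also not a function of `q mod m`, so NG stays plausible) — REF1 suggests a `¬CM` guard to keep the candidate inside D-0131(3)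
(not applied here: body verbatim; -desc's call); presearch (REF1): `lit search "governing field 2-Selmer quadratic twist"` / galaxy `"governing field|spin of prime ideals"`: no
`S₃`-image elliptic analogue found [corpus+galaxy].  REF2-PLACEMENT v49 §5.2 (333e5dcafceb55cb): -desc's placement accurate — NEAREST CONTRASTING PRINT [cite: Smith2016GoverningFields, Thm. 3.2]
(a governing field EXISTS when `E[2] ⊂ E(ℚ)` — opposite sign, disjoint hypothesis); printed TEMPLATE [cite: KoymansMilovic2021Spins, Thm. 3] (no governing field for the 16-rank
of `Cl(ℚ(√−4p))`, conditional on `C_n`; mechanism [cite: FIMR2013Spin, §12]); v49: «NG/NG₁ NOT IN PRINT (elliptic `S₃` analogue absent, corpus+galaxy), conjecture-grade,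
NEW-COMBINATION» — **CORRECTED by REF2 v50 §1.8(b) (dbb0660368a6f605)**: with [cite: Morgan2023KummerGeneric, Prop. 19, Prop. 26, Prop. 31, Cor. 34] in print (`θ(q) = c_W +
ψ_{a,b}(Frob_q)`, and over every 3-cycle BOTH ψ-values occur in `Gal(K_{T,T′}/K)`), NG's `K_T`-part is a COROLLARY OF PRINT (Cor. 34 + Čebotarev), the `ℚ^{ab}` enlargement is two
lines (`Gal(M_W/L) ≅ 2^{1+4}_+` non-abelian, `M_W ∩ ℚ^{ab} = L ∩ ℚ^{ab}`), and the `ℚ(E[2^∞])` enlargement («`M_W ⊄ K_T·ℚ^{ab}·ℚ(E[2^k])`») is the ONE residual lemma, not in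
print, census-backed (TEST 33 / ENGINE 34) ⟹ grade now **COROLLARY-OF-PRINT candidate (Cor. 34 + disjointness lemma)**, no longer «beyond-print conjecture»; REF2 trap T50-4:
Morgan never says «governing» — search the mechanism words. -/
@[conjecture] def NoResidueTraceGoverningLawAtTwo : Prop :=
  ∀ (W : WeierstrassCurve ℚ) [W.IsElliptic] [W.IsGloballyMinimal], OnOddBranchAtTwo W →
    ∀ m k : ℕ, 0 < m →
      ∃ q q' : ℕ, q.Prime ∧ q'.Prime ∧ DescAdmissible W (-(q : ℤ)) ∧ DescAdmissible W (-(q' : ℤ)) ∧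
        (q : ZMod m) = q' ∧ (W.frobeniusTrace q : ZMod (2 ^ k)) = W.frobeniusTrace q' ∧
        ShaTwoInTwiceShaFour (W.quadraticTwist (-(q : ℚ))) ∧ ¬ ShaTwoInTwiceShaFour (W.quadraticTwist (-(q' : ℚ)))

/-- Glue: DESC-30-NG refutes every residue–trace law, PROVIDED the odd branch is inhabited (it is: `360693d1`, tree DESC-M⁻ witnesses). -/
theorem not_residueTraceLaw_of_noGoverningLaw (hng : NoResidueTraceGoverningLawAtTwo)
    (hW : ∃ (W : WeierstrassCurve ℚ) (_ : W.IsElliptic) (_ : W.IsGloballyMinimal), OnOddBranchAtTwo W)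
    (m k : ℕ) (hm : 0 < m) : ¬ CasselsTateSignResidueTraceLawAtTwo m k := by
  intro hlaw
  obtain ⟨W, hE, hM, hodd⟩ := hW
  obtain ⟨q, q', hq, hq', hd, hd', hqq, haa, hpos, hneg⟩ := hng W hodd m k hm
  exact hneg ((hlaw W hodd q q' hq hq' hd hd' hqq haa).mp hpos)

/-- **DESC-30-F_k `DoorFrobeniusRigidityAtTwo k` (THEOREM-GRADE, linear algebra; the matrix core of the door rigidity lemma).** Two `2 × 2` matrices
over `ℤ/2^k` with the same ODD trace and the same ODD (= unit) determinant are conjugate by an invertible matrix.  (Proof: `R = (ℤ/2^k)[X]/(X² − tX + n)`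
is local with residue field `𝔽₄` when `t` is odd; `(ℤ/2^k)²` with `X ↦ A` is a cyclic, hence free rank-one, `R`-module by Nakayama; two free rank-one
structures are `R`-isomorphic.)  Consequence (memo §30.3): for a good prime `q` with `a_q` odd and surjective mod-`2^k` image, the class of `Frob_q` in
`GL₂(ℤ/2^k)`, and in the Galois group of any compositum of `2`-power torsor fields over `ℚ(E[2^k], ζ_m)`, is determined by `(q mod 2^k m, a_q mod 2^k)`.
REF1-AUDIT §182: **SURVIVES, THEOREM-GRADE** (the Galois-ring argument is correct: `t`, `n` odd ⟹ `X² − tX + n ≡ X² + X + 1 (mod 2)` irreducible ⟹ `R = (ℤ/2^k)[X]/(X² − tX + n) =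
GR(2^k, 2)` local with residue field `𝔽₄`; `(ℤ/2^k)²` is cyclic over `R` by Nakayama, hence free of rank 1 by counting; two such structures are `R`-isomorphic ⟹ conjugate);
E-side brute force `k = 1, 2, 3, 4`: `|GL₂(ℤ/2^k)| = 6, 96, 1 536, 24 576`; odd `(tr, det)` classes `1, 4, 16, 64`, each a single GL₂-orbit of size `2·4^{k−1}` (centraliser
`R^×` of order `3·4^{k−1}`) ✓; control: EVEN trace, odd det at `k = 2` splits into up to 5 orbits — the `Odd trace` hypothesis is load-bearing; C182g (below): the `k = 0` rung by
`decide` (vacuous, `ZMod 1`); -desc's `k = 1` rung `doorFrobeniusRigidityAtTwo_one` re-elaborates; typing ✓ (`P * Q = 1` ⟹ `P` invertible over a commutative ring; `P * A = B * P`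
is conjugacy).  REF2-PLACEMENT v49 §5.2: **KNOWN** (folklore: a non-scalar reduction over a local ring is similar to the companion matrix; odd trace ⟹ non-scalar mod 2); not beyond
print in substance (Galois rings / Nakayama); `k ≥ 2` open in the kernel (M-sized).  REF2's structural note for -desc: F_k alone does not separate NG from Rédei-type GOVERNED
invariants (those also fail every residue–trace test); the separator is F_k PLUS torsor blindness at fixed-point-free Frobenius — «a 3-cycle `Frob_q` fixes no vector of `E[2]`,
hence of `E[2^j]`, so `Ĥ⁰ = 0` and (Herbrand) `H¹(⟨Frob_q⟩, E[2^j]) = 0`: every 2-power torsor splits at `q` in a way fixed by the division-field Frobenius» — REF2 asks -desc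
to STATE that one-line lemma next to F_k (it, not the census, makes NG the analogue of [cite: KoymansMilovic2021Spins, Thm. 3]); after v50 §1.8 the signed object is Morgan's
`ψ_{a,b}(Frob_q)` ∈ the centre of `Gal(K_{T,T′}/K)` ([cite: Morgan2023KummerGeneric, Prop. 31]). -/
def DoorFrobeniusRigidityAtTwo (k : ℕ) : Prop :=
  ∀ A B : Matrix (Fin 2) (Fin 2) (ZMod (2 ^ k)),
    Odd (A.trace).val → Odd (A.det).val → A.trace = B.trace → A.det = B.det →
      ∃ P Q : Matrix (Fin 2) (Fin 2) (ZMod (2 ^ k)), P * Q = 1 ∧ P * A = B * P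

/-- Kernel rung of DESC-30-F: the case `k = 1` (`GL₂(𝔽₂) ≅ S₃`: the two elements of odd trace and odd determinant are the 3-cycles). -/
theorem doorFrobeniusRigidityAtTwo_one : DoorFrobeniusRigidityAtTwo 1 := by
  unfold DoorFrobeniusRigidityAtTwo
  decide

/-- DESC-30-F (all levels): the rigidity lemma for every `k` (the `k = 0` case is vacuous). THEOREM-GRADE; open in the kernel for `k ≥ 2`.
REF1-AUDIT §182: THEOREM-GRADE (all `k`; `k = 0` C182g, `k = 1` -desc's `decide` rung, `k ≥ 2` open in the kernel). -/
def DoorFrobeniusRigidityAllAtTwo : Prop := ∀ k : ℕ, DoorFrobeniusRigidityAtTwo k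

/-- **DESC-30-N₀ `OddBranchRankOneTwinShaAnBitAtTwo` (`@[conjecture]`; rank-0 companion of DESC-N; two-engine census ENGINE 34: 5 601/5 601).** For `W`
on the rank-one odd branch, admissible `d`, and `W'` a globally minimal model of `W^{(d)}` of analytic rank `0`: `θ(W') = + ⇒ 16 ∣ #Ш_an(W')` and
`θ(W') = − ⇒ #Ш_an(W') ≡ 4 (mod 8)` (`Sel₂(W') = Ш(W')[2] ≅ (ℤ/2)²` contains the capitulated Kummer class of the generator of `W(ℚ)`).
[cite: Kolyvagin1990, Thm. A (rank 0 and finite Ш for the analytic-rank-0 twin, so `#Ш_an` is the BSD₂ prediction being read)]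
REF1-AUDIT §182: **SURVIVES as `@[conjecture]` = a CONSEQUENCE of BSD₂ for the analytic-rank-0 twin (prediction row, not beyond-print)**: `Sel₂(W') = Ш(W')[2] ≅ (ℤ/2)²` (rank 0 by
Kolyvagin from `analyticRank = 0`; `#Sel₂(W^{(d)}) = 4` from the branch; odd torsion), `θ = +` ⟺ `Ш[2] ⊆ 2Ш[4]` ⟹ `16 ∣ #Ш(W')[2^∞]`, `θ = −` ⟹ `Ш(W')[2^∞] = (ℤ/2)²`
exactly; BSD₂(W') turns these into `16 ∣ #Ш_an` / `#Ш_an ≡ 4 (8)`; two-engine census re-tallied (`check182b.py`): `θ_alg = [s = 0]` vs `v₂ S(q) ≥ v_min + 2 ∨ S = 0`: 5 601/5 601,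
0 odd `v₂(Ш_an)` readings; typing ✓.  REF2-PLACEMENT v49 §5.2: a BSD₂-PREDICTION row (print neighbours for `v₂` of prime-twist `L`-values: [cite: Zhai2016, Thm. 1.1] / Cai–Li–Zhai — the MINIMAL-valuation layer only;
REF2 v50 §1.5 Q31: whether the analytic side sees Morgan's `ψ_{a,b}(Frob_q)` one bit above the minimal one is NOT IN PRINT / OPEN and BSD₂-equivalent on this family); same grade as tree
DESC-N `OddBranchTwistShaAnBitAtTwo` (BSD₂ instance). -/
@[conjecture] def OddBranchRankOneTwinShaAnBitAtTwo : Prop :=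
  ∀ (W : WeierstrassCurve ℚ) [W.IsElliptic] [W.IsGloballyMinimal], OnOddBranchRankOneAtTwo W →
    ∀ d : ℤ, DescAdmissible W d →
      ∀ (W' : WeierstrassCurve ℚ) [W'.IsElliptic] [W'.IsGloballyMinimal],
        (∃ C : VariableChange ℚ, C • W.quadraticTwist (d : ℚ) = W') → W'.analyticRank = 0 →
          (ShaTwoInTwiceShaFour W' → ∃ n : ℕ, shaAn W' = (n : ℂ) ∧ 16 ∣ n) ∧
          (¬ ShaTwoInTwiceShaFour W' → ∃ n : ℕ, shaAn W' = (n : ℂ) ∧ n % 8 = 4)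

/-- The rank-one-branch analogue of DESC-30-NG (ENGINE 34 census: witnesses in 24/24 curves for `(m,k) = (16·rad_odd N, 2)`; ratio 1.00 ± 0.05 in 21 keys).
REF1-AUDIT §182: SURVIVES as `@[conjecture]` (as NG; ENGINE 34: two engines for the bit, 5 601/5 601; witnesses 24/24 curves for `(16·rad_odd N, 2)`).  REF2-PLACEMENT v49 §5.2 / v50 §1.8: as NG above
(COROLLARY-OF-PRINT candidate: [cite: Morgan2023KummerGeneric, Prop. 19, Cor. 34] + the `ℚ(E[2^∞])`-disjointness lemma; was «conjecture, new-combination» at v49). -/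
@[conjecture] def NoResidueTraceGoverningLawRankOneAtTwo : Prop :=
  ∀ (W : WeierstrassCurve ℚ) [W.IsElliptic] [W.IsGloballyMinimal], OnOddBranchRankOneAtTwo W →
    ∀ m k : ℕ, 0 < m →
      ∃ q q' : ℕ, q.Prime ∧ q'.Prime ∧ DescAdmissible W (-(q : ℤ)) ∧ DescAdmissible W (-(q' : ℤ)) ∧
        (q : ZMod m) = q' ∧ (W.frobeniusTrace q : ZMod (2 ^ k)) = W.frobeniusTrace q' ∧
        ShaTwoInTwiceShaFour (W.quadraticTwist (-(q : ℚ))) ∧ ¬ ShaTwoInTwiceShaFour (W.quadraticTwist (-(q' : ℚ)))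

/-! ## REF1 §182 kernel certificates C182f, C182g (sorry-free; `REF1-data/b182/lean/Probe182b.lean` l.110–125 VERBATIM) -/

/-- **C182f** (the side condition `0 < m` of DESC-30-NG is load-bearing): at modulus `m = 0` (`ZMod 0 = ℤ`) the residue–trace law holds
trivially for every `k`, because `(q : ZMod 0) = q'` forces `q = q'`.  So NG without `0 < m` would be refuted by `m = 0`. -/
theorem residueTraceLaw_zero_modulus (k : ℕ) : CasselsTateSignResidueTraceLawAtTwo 0 k := by
  intro W _ _ _ q q' _ _ _ _ hqq _
  have h : (q : ℤ) = (q' : ℤ) := hqq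
  have hq : q = q' := by exact_mod_cast h
  subst hq
  exact Iff.rfl

/-- **C182g** (degenerate rung): `DoorFrobeniusRigidityAtTwo 0` holds vacuously (`ZMod 1`: no odd trace). -/
theorem doorFrobeniusRigidityAtTwo_zero : DoorFrobeniusRigidityAtTwo 0 := by
  unfold DoorFrobeniusRigidityAtTwo
  decide


end Summit.BirchSwinnertonDyer.Rank1Residual.F1Sign2

end
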